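import Literature.NumberTheory.LFunctions.ZetaLowHeightZeros
import HarnessLib

/-!
# Kernel-checked certificate: `ζ' ≠ 0` on `(0, ½) × (3, 11/2]`

Trunk T-ANT (NumberTheory/LFunctions). One of the seven certificate files of the certified
low-height computation behind `Literature.NumberTheory.LFunctions.speiser_iff` (Levinson–Montgomery's Theorem 1 (1.2) needs
`ζ ≠ 0` on `(0,½) × (0, 10.5]` and `ζ' ≠ 0` on `(0,½) × (0, 10]`; classically Gram 1903 and
Spira 1965). The literal `Literature.NumberTheory.LFunctions.ZetaLowHeightZeros.ZetaNum.certDZeta3to5h` lists, for the four edges of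
`[0, ½] × [3, 11/2]`, pieces with quadrant labels (scaled integers at `2^48`); it was produced by
an external planner that mirrors the checker bit for bit, but its validity rests only on the
kernel evaluation `Literature.RH.ZetaNum.certDZeta3to5h_ok : certCheck 1 certDZeta3to5h = true`
(`decide +kernel`, Euler–Maclaurin `N = 6` enclosures in fixed-point interval arithmetic and the
winding-number certificate theorem; see `ZetaLowHeightZeros.lean`). No axioms beyond
`propext`, `Classical.choice`, `Quot.sound`.

## Main results

* `Literature.NumberTheory.LFunctions.ZetaLowHeightZeros.ZetaNum.certDZeta3to5h_ok` — the kernel check.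
* `Literature.NumberTheory.LFunctions.ZetaLowHeightZeros.ZetaNum.deriv_riemannZeta_ne_zero_DZeta3to5h` — `ζ'(s) ≠ 0` for `0 < Re s < ½`, `3 < Im s ≤ 11/2`.
-/

namespace Literature.NumberTheory.LFunctions.ZetaLowHeightZeros.ZetaNum

/-- The certificate data for `ζ'` on `[0, ½] × [3, 11/2]` (bottom, right, top, left edges).
[folklore] -/
def certDZeta3to5h : ZetaNum.Cert :=
  ⟨844424930131968, 1548112371908608, 42609296801792, 0, [(92209726619648, 0), (140737488355328, 0)],
  881885634887680, 0, [(919277620166656, 0), (956810265624576, 0), (994508267323392, 0), (1032001184333824, 0), (1069480142700544, 0), (1107106203697152, 0), (1145012511309824, 0), (1183304292237312, 0), (1222054560923648, 0), (1260644842078208, 0), (1298685367418880, 0), (1336056951603200, 0), (1372825092882432, 0), (1409034888413184, 0), (1444709960515584, 0), (1481511387791360, 3), (1519020410929152, 3), (1548112371908608, 3)],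
  47681653178368, 0, [(100727720509440, 3), (140737488355328, 3)],
  869138171953152, 0, [(893938386862080, 0), (918891073110016, 0), (944058507722752, 0), (969497599016960, 0), (995144996225024, 0), (1020814942011392, 0), (1046571860885504, 0), (1072476956131328, 0), (1098586062323712, 0), (1124950719070208, 0), (1151619244752896, 0), (1178634589044736, 0), (1206032185425920, 0), (1233837803700224, 0), (1261531752824832, 0), (1289137655119872, 0), (1316676985421824, 0), (1344166923599872, 0), (1371624649523200, 0), (1399064121835520, 0), (1426340385390592, 0), (1453448071479296, 0), (1480653468073984, 3), (1508246485467136, 3), (1536264704622592, 3), (1548112371908608, 3)]⟩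

/-- **The kernel check of the certificate.** [folklore] -/
theorem certDZeta3to5h_ok : ZetaNum.certCheck 1 certDZeta3to5h = true := by
  decide +kernel

/-- **`ζ'(s) ≠ 0` for `0 < Re s < ½`, `3 < Im s ≤ 11/2`** (certified computation).
[folklore] -/
theorem deriv_riemannZeta_ne_zero_DZeta3to5h {s : ℂ} (h0 : 0 < s.re) (h1 : s.re < 1 / 2)
    (h2 : (3 : ℝ) < s.im) (h3 : s.im ≤ 11 / 2) : deriv riemannZeta s ≠ 0 :=
  ZetaNum.deriv_riemannZeta_ne_zero_of_certCheck certDZeta3to5h_ok h0 h1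
    (by norm_num [certDZeta3to5h, Literature.Analysis.ValidatedNumerics.Numerics.SC]; exact h2)
    (by norm_num [certDZeta3to5h, Literature.Analysis.ValidatedNumerics.Numerics.SC]; exact h3)

end Literature.NumberTheory.LFunctions.ZetaLowHeightZeros.ZetaNum
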